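import Literature.NumberTheory.Rogawski1990.ArchOrbFamGUnfoldedModel                 -- ★ (A5a) p851098 (F0P3b-p01 (g16)): `archRG_eq_prod_cpt_mul_prod_split`, `splitCoord_eq_add_half_add_half`, `integral_prod_eq_integral_swap_descConj`; brings ★ (A2)+(A3) `prod_normaliser_smul_integral_pi_descConj_eq_smul_integral_pi_prod_symm`, ★ `orbFamG_apply`
import Literature.NumberTheory.Rogawski1990.ArchChartOrbGIsolatePlaceSplitQuotient   -- ★ (J2-a) part 1 p851339 (this seat): `chartOrbG_eq_prod_mul_integral_group_isolate_splitQuotient`; brings ★ (J-iso) p851229, ★ (A4) `forall_mem_pi_chartTorusGLoc_comm`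
import HarnessLib

/-!
# (B3-JUNCTION) J2-a, part 2 — THE UNFOLDED MODEL OF `orbFamG` WITH ONE COMPACT PLACE `w₀` ISOLATED, BINDER-FREE ON `RegG` («isolation in the unfolded currency»;
# Rogawski 1990 §4.9, §8.2–8.3; Folland 1995 §2.6 (2.52); Shelstad 1979 §4)

Topic `NumberTheory/Rogawski1990`; namespace `Literature.NumberTheory.Rogawski1990` (as ★ (A5a) §3).  THEOREMS ONLY (no `def`, no instance, no notation, no axiom, no named
fact, no `sorry`).  Cell `pub/hodgecm-mathlib`, crux H413 (`stmt-HodgeConjecture-24833`), F0∕P3c line LH3 (closer stub `stub_N9`, DIRECT ROAD `F0_P3c_StubN9Direct`, LEAF v6),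
organ O-L1d «HC-CENTRAL ∕ SCALAR CORNERS» (`stub_N9hcCentralJetBounds`), road (B3) of RULING #18: brick **(J2-a)** of A-p12 (g28)'s J2 census (2026-09-02T11:29:26Z; dealer
LH3-plan (g4) 11:37:33Z «(J2-a) → p05»), seat F0P3a-p05 (g21).  Count-neutral measure-theoretic bookkeeping: nothing here closes an organ.

THE MATHEMATICS.  ★ (A5a) `orbFamG_eq_unfoldedModel_of_regG` writes the raw normalised orbital-integral chart family `orbFamG ν′ a′ S′` on the `G`-regular set as
`(compact factors) · (Π_w t_w(B′_w)) · (Π_{w∈S′} C_w) · ∫ a′(…) d((⊗_{w∈S′} κ ⊗ μ_N) ⊗ ((⊗_{w∉S′} ν′_w) ∕ ρ_cpt))` — the split places UNFOLDED to `K × N` (Shelstad's `Δ_w`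
absorbed, ★ (A2)+(A3)), the compact places as ONE quotient `(Π_{w∉S′} U_w) ⧸ Π_{w∉S′} T′_w`.  Here ONE compact-chart place `w₀ ∉ S′` is ISOLATED from that quotient: with the
remaining compact places indexed by the FLAT subtype `ι := {w ∕∕ w ∉ S′ ∧ w ≠ w₀}` (the index of ★ (J2-b) `contDiffOn_partialUnfoldedModel`) and an inversion-invariant Haar
measure `ρ_ι` on `Π_ι T′_w` with coordinates `⊗_ι t_w` (`hρι`), for `c ∈ RegG S′` and `a′ ∈ C_c(G′_∞)`:
* **`orbFamG_eq_unfoldedModel_isolate_of_regG`** (group form; the `hIso` input of A-p12 (g28)'s (J2-c) closer `…_of_scalarCorner`, head «=» 11:50:58Z):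
  `orbFamG ν′ a′ S′ c = (Π_{w∉S′} (1−e^{i(φ−θ)})(1−e^{i(ψ−θ)})(1−e^{i(ψ−φ)})) · (Π_{w≠w₀} t_w(B′_w)) · (Π_{w∈S′} C_w) ·
     ∫_{U(α)_{w₀}} ( ∫_{((Π_ι U_w)⧸Π_ι T′_w) × (K×N)^{S′}} descConj γ_ι(c) (Π_ι T′) (g ↦ a′(e⁻¹(x γ_{w₀}(c) x⁻¹ ∣ φ_w⁻¹(k_w τ(0,φ_w,θ_w) τ(x_w∕2,0,0) n_w τ(x_w∕2,0,0) k_w⁻¹) ∣ g_w)))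
        d(((⊗_ι ν′_w)∕ρ_ι) ⊗ (⊗_{S′} κ⊗μ_N)) ) dν′_{w₀}(x)`
  — the `w₀`-variable OUTSIDE as a WHOLE-GROUP integral (no torus measure at `w₀`: `t_{w₀}(B′_{w₀}) = t_{w₀}(T′_{w₀})` cancels, ★ (J-iso) §2), the quotient FIRST and the split fibre
  SECOND inside (the order of ★ (A4′)∕(J2-b)).  ROUTE (measure identities only, no integrability beyond ★ (J-iso) §2's): `orbFamG = R′·chartOrbG` (★ `orbFamG_apply`, ★
  `archRG_eq_prod_cpt_mul_prod_split`) ∘ ★ part 1 `chartOrbG_eq_prod_mul_integral_group_isolate_splitQuotient` (the `w₀`-place a whole group, the split places local quotients, the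
  remaining compact places ONE flat-ι quotient) ∘ ★ (A2)+(A3) `prod_normaliser_smul_integral_pi_descConj_eq_smul_integral_pi_prod_symm` INSIDE the `x`-integral (spectator = the
  ι-quotient; Shelstad's `Δ_w` absorbed into the `K × N` chart) ∘ ★ (A5b) `integral_prod_eq_integral_swap_descConj`.  (The binder-form sibling with the nested index and the full-group
  inner integral is ★ p851312 `orbFamG_eq_unfoldedModel_group_isolate` (F0P3a-p07 (g18)), file `ArchOrbFamGUnfoldedModelIsolate`.)
HONEST LABEL: HC_CM is proved only modulo the 7 printed citations (2 remaining: hLiu418 = `stmt-HodgeConjecture-24832`, h413 = `stmt-HodgeConjecture-24833`) until rung 0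
closes; this file moves no row of the books.

## References
* [Rogawski1990] J. D. Rogawski, *Automorphic Representations of Unitary Groups in Three Variables*, Ann. of Math. Stud. 123 (1990), §4.9 (4.9.1)–(4.9.2) p. 55, §8.2 p. 122,
  §8.3 p. 124 (orbital integrals on the regular set, place by place; parabolic descent at the split places).
* [Folland1995] G. B. Folland, *A Course in Abstract Harmonic Analysis* (1995), §2.2, §2.6 Thm. 2.49, (2.52).
* [Shelstad1979] D. Shelstad, *Characters and inner forms of a quasi-split group over ℝ*, Compositio Math. 39 (1979), §4 pp. 22–24.
* [Gelbart1975] S. Gelbart, *Automorphic Forms on Adele Groups* (1975), §10 p. 155 (10.19).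
* [BorelJacquet1979] A. Borel, H. Jacquet, *Automorphic forms and automorphic representations*, PSPM 33.1 (1979), §4.1.
* [DeitmarEchterhoff2014] A. Deitmar, S. Echterhoff, *Principles of Harmonic Analysis*, 2nd ed. (2014), Thm. 1.5.3, Cor. 1.5.4, Lemma 9.3.3.
-/

set_option autoImplicit false

noncomputable section

open MeasureTheory MeasureTheory.Measure Set NumberField NumberField.InfinitePlace Complex Topology
open Literature.MeasureTheory.Group Literature.NumberTheory.Automorphic Literature.NumberTheory.Automorphic.UnitaryGroup Literature.NumberTheory.Automorphic.ArchCartan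
open scoped ContDiff Classical ENNReal NNReal MatrixGroups

namespace Literature.NumberTheory.Rogawski1990

section Isolate

variable (L : Type) [Field L] [NumberField L] [IsCMField L] (α : Fin 3 → L) (S' : Finset {w : InfinitePlace L // IsComplex w})
  [∀ w : {w : InfinitePlace L // IsComplex w}, MeasurableSpace ↥(archLocal L 3 (Matrix.diagonal α) w)]
  [∀ w : {w : InfinitePlace L // IsComplex w}, BorelSpace ↥(archLocal L 3 (Matrix.diagonal α) w)]
  [∀ w : {w : InfinitePlace L // IsComplex w}, LocallyCompactSpace ↥(archLocal L 3 (Matrix.diagonal α) w)]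
  [∀ w : {w : InfinitePlace L // IsComplex w}, SecondCountableTopology ↥(archLocal L 3 (Matrix.diagonal α) w)]
  [MeasurableSpace ↥(arch (↥(maximalRealSubfield L)) L (IsCMField.complexConj L) 3 (Matrix.diagonal α))]
  [BorelSpace ↥(arch (↥(maximalRealSubfield L)) L (IsCMField.complexConj L) 3 (Matrix.diagonal α))]
  [∀ w : {w : InfinitePlace L // IsComplex w}, MeasurableSpace (↥(archLocal L 3 (Matrix.diagonal α) w) ⧸ chartTorusGLoc L α w S')]
  [∀ w : {w : InfinitePlace L // IsComplex w}, BorelSpace (↥(archLocal L 3 (Matrix.diagonal α) w) ⧸ chartTorusGLoc L α w S')]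
  (ν'w : ∀ w : {w : InfinitePlace L // IsComplex w}, Measure ↥(archLocal L 3 (Matrix.diagonal α) w)) [∀ w, (ν'w w).IsHaarMeasure] [∀ w, (ν'w w).IsMulRightInvariant]
  (ν' : Measure ↥(arch (↥(maximalRealSubfield L)) L (IsCMField.complexConj L) 3 (Matrix.diagonal α))) [ν'.IsHaarMeasure] [ν'.IsMulRightInvariant]
  (hν : ν' = (Measure.pi ν'w).map (archPiEquivCM 3 L (Matrix.diagonal α)).symm)
  (t : ∀ w : {w : InfinitePlace L // IsComplex w}, Measure ↥(chartTorusGLoc L α w S')) [∀ w, (t w).IsHaarMeasure] [∀ w, (t w).IsInvInvariant]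
  -- the standard split group `U(J₃)(ℂ)` and the per-place transports (★ (A2)), VERBATIM ★ (A5a)
  {J : Matrix (Fin 3) (Fin 3) ℂ} (hJ : J = (StdForm.antidiagonal 3).over ℂ)
  [MeasurableSpace ↥(unitaryGroupOfForm (starRingEnd ℂ) J)] [BorelSpace ↥(unitaryGroupOfForm (starRingEnd ℂ) J)]
  [MeasurableSpace (↥(unitaryGroupOfForm (starRingEnd ℂ) J) ⧸ torusU (starRingEnd ℂ) J)] [BorelSpace (↥(unitaryGroupOfForm (starRingEnd ℂ) J) ⧸ torusU (starRingEnd ℂ) J)]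
  (φ : ∀ w : {w : {w : InfinitePlace L // IsComplex w} // w ∈ S'}, ↥(archLocal L 3 (Matrix.diagonal α) w.1) ≃ₜ* ↥(unitaryGroupOfForm (starRingEnd ℂ) J))
  (hφT : ∀ (w : {w : {w : InfinitePlace L // IsComplex w} // w ∈ S'}) (g : ↥(archLocal L 3 (Matrix.diagonal α) w.1)),
    (φ w).toMulEquiv g ∈ torusU (starRingEnd ℂ) J ↔ g ∈ chartTorusGLoc L α w.1 S')
  (hφd : ∀ (w : {w : {w : InfinitePlace L // IsComplex w} // w ∈ S'}) (cw : Fin 3 → ℝ),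
    glDiagonal 3 ℂ (fun i => Units.mk0 (boostEig cw i) (boostEig_ne_zero cw i)) = ((φ w (gprimeBlockAt L α w.1 S' cw) : ↥(unitaryGroupOfForm (starRingEnd ℂ) J)) : GL (Fin 3) ℂ))
  {K : Subgroup ↥(unitaryGroupOfForm (starRingEnd ℂ) J)} (κ : Measure ↥K) [SigmaFinite κ]
  (μN : Measure ↥(unipotentU (starRingEnd ℂ) J)) [IsHaarMeasure μN]
  {C : {w : {w : InfinitePlace L // IsComplex w} // w ∈ S'} → ℝ≥0}
  (hμC : ∀ w : {w : {w : InfinitePlace L // IsComplex w} // w ∈ S'},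
    (quotientMeasure (chartTorusGLoc L α w.1 S') (t w.1) (isClosed_chartTorusGLoc L α w.1 S') (ν'w w.1)).map
        (cosetCongr (φ w).toMulEquiv (chartTorusGLoc L α w.1 S') (torusU (starRingEnd ℂ) J) (hφT w)) =
      C w • Measure.map
        (fun p : ↥K × ↥(unipotentU (starRingEnd ℂ) J) =>
          (QuotientGroup.mk ((p.1 : ↥(unitaryGroupOfForm (starRingEnd ℂ) J)) * (p.2 : ↥(unitaryGroupOfForm (starRingEnd ℂ) J))) :
            ↥(unitaryGroupOfForm (starRingEnd ℂ) J) ⧸ torusU (starRingEnd ℂ) J))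
        (κ.prod μN))
  -- the boost torus family on `U(J₃)(ℂ)` (★ `exists_torusU_boostEig_family`), VERBATIM ★ (A5a)
  (τ : (Fin 3 → ℝ) → ↥(unitaryGroupOfForm (starRingEnd ℂ) J)) (hτT : ∀ c, τ c ∈ torusU (starRingEnd ℂ) J)
  (hτcoe : ∀ c, (((τ c : ↥(unitaryGroupOfForm (starRingEnd ℂ) J)) : GL (Fin 3) ℂ) : Matrix (Fin 3) (Fin 3) ℂ) = Matrix.diagonal (boostEig c))
  (hτmul : ∀ c c', τ (c + c') = τ c * τ c')
  (hτd : ∀ c, ∃ d : Fin 3 → ℂˣ, glDiagonal 3 ℂ d = ((τ c : ↥(unitaryGroupOfForm (starRingEnd ℂ) J)) : GL (Fin 3) ℂ) ∧ ∀ i, (d i : ℂ) = boostEig c i)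
  -- NEW: the isolated compact place `w₀` and the quotient of the REMAINING compact places, flat index `ι = {w ∕∕ w ∉ S′ ∧ w ≠ w₀}` (as ★ (J2-b))
  (w₀ : {w : InfinitePlace L // IsComplex w})
  [MeasurableSpace ((∀ i : {w : {w : InfinitePlace L // IsComplex w} // w ∉ S' ∧ w ≠ w₀}, ↥(archLocal L 3 (Matrix.diagonal α) i.1)) ⧸
    Subgroup.pi Set.univ (fun i : {w : {w : InfinitePlace L // IsComplex w} // w ∉ S' ∧ w ≠ w₀} => chartTorusGLoc L α i.1 S'))]
  [BorelSpace ((∀ i : {w : {w : InfinitePlace L // IsComplex w} // w ∉ S' ∧ w ≠ w₀}, ↥(archLocal L 3 (Matrix.diagonal α) i.1)) ⧸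
    Subgroup.pi Set.univ (fun i : {w : {w : InfinitePlace L // IsComplex w} // w ∉ S' ∧ w ≠ w₀} => chartTorusGLoc L α i.1 S'))]
  (ρι : Measure ↥(Subgroup.pi Set.univ (fun i : {w : {w : InfinitePlace L // IsComplex w} // w ∉ S' ∧ w ≠ w₀} => chartTorusGLoc L α i.1 S')))
  [ρι.IsHaarMeasure] [ρι.IsInvInvariant]
  (hρι : Measure.map (subgroupPiCoords fun i : {w : {w : InfinitePlace L // IsComplex w} // w ∉ S' ∧ w ≠ w₀} => chartTorusGLoc L α i.1 S') ρι =
    Measure.pi fun i : {w : {w : InfinitePlace L // IsComplex w} // w ∉ S' ∧ w ≠ w₀} => t i.1)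

include hν hJ hφT hφd hμC hτT hτcoe hτmul hτd hρι in
/-- **(J2-a) THE UNFOLDED MODEL WITH THE COMPACT PLACE `w₀` ISOLATED (group form).**  Binders = ★ (A5a) `orbFamG_eq_unfoldedModel_of_regG`'s (frame `hα hS′`, product reading `hν`,
torus measures `t_w`, split frames `φ_w` with `hφT hφd`, ONE compact `K ≤ U(J₃)(ℂ)` with `κ`, `μ_N`, Iwasawa constants `hμC`, boost torus `τ` with `hτT hτcoe hτmul hτd`) MINUS the
`Π_{w∉S′}`-quotient data, PLUS `hw₀ : w₀ ∉ S′`, the ι-quotient data `ρ_ι`, `hρι` (`ι = {w ∕∕ w ∉ S′ ∧ w ≠ w₀}`), compact support `ha′s` and `G`-regularity `hc`.  THEN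
`orbFamG ν′ a′ S′ c = (Π_{w∉S′} (1−e^{i(φ−θ)})(1−e^{i(ψ−θ)})(1−e^{i(ψ−φ)})) · (Π_{w≠w₀} t_w(B′_w)) · (Π_{w∈S′} C_w) · ∫_{U(α)_{w₀}} ( ∫ descConj γ_ι(c) (Π_ι T′_w) (g ↦ a′(e⁻¹(…)))
d(((⊗_ι ν′_w)∕ρ_ι) ⊗ (⊗_{S′} κ⊗μ_N)) ) dν′_{w₀}(x)`, the assembled element having `x γ_{w₀}(c) x⁻¹` at `w₀` (Mathlib `piEquivPiSubtypeProd (· = w₀)` + `piUnique`, ★ (J-iso) §2's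
shape), `φ_w⁻¹(k_w τ(0,φ_w,θ_w) τ(x_w∕2,0,0) n_w τ(x_w∕2,0,0) k_w⁻¹)` at `w ∈ S′` (★ (A5a)'s split word) and `g_w` at `w ∈ ι`.  Measure identities only: ★ `orbFamG_apply`, ★ (A5a) §0,
★ (J-iso) §2, the index split `{w ≠ w₀} = S′ ⊔ ι` (`piEquivPiSubtypeProd`, `piCongrLeft`), ★ `map_quotientPiHomeomorph_quotientMeasure_pi`, ★ (A2)+(A3) inside the `x`-integral,
★ (A5b) swap. [cite: Rogawski1990, §4.9 (4.9.1)–(4.9.2) p. 55; §8.2 p. 122; §8.3 p. 124] [cite: Folland1995, §2.6 Thm. 2.49, (2.52)] [cite: Shelstad1979, §4 pp. 22–24]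
[cite: Gelbart1975, §10 p. 155 (10.19)] [cite: DeitmarEchterhoff2014, Thm. 1.5.3; Lemma 9.3.3] [cite: BorelJacquet1979, §4.1] -/
theorem orbFamG_eq_unfoldedModel_isolate_of_regG (hα : ∀ i, α i ≠ 0) (hS' : ∀ w, w ∈ S' → w ∈ splitChartPlaces L α) (hw₀ : w₀ ∉ S')
    {a' : ↥(arch (↥(maximalRealSubfield L)) L (IsCMField.complexConj L) 3 (Matrix.diagonal α)) → ℂ} (ha'c : Continuous a') (ha's : HasCompactSupport a')
    {c : {w : InfinitePlace L // IsComplex w} → Fin 3 → ℝ} (hc : c ∈ RegG S') :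
    orbFamG L α ν' a' S' c =
      (∏ w ∈ Finset.univ.filter (fun w => w ∉ S'),
          ((1 - (Circle.exp (c w 1 - c w 0) : ℂ)) * (1 - (Circle.exp (c w 2 - c w 0) : ℂ)) * (1 - (Circle.exp (c w 2 - c w 1) : ℂ)))) *
        (∏ w' : {w : {w : InfinitePlace L // IsComplex w} // ¬ w = w₀}, ((t w'.1 (chartBoxImgGLoc L α w'.1 S')).toReal : ℂ)) *
        ((∏ w : {w : {w : InfinitePlace L // IsComplex w} // w ∈ S'}, (C w : ℝ) : ℝ) : ℂ) *
        ∫ x : ↥(archLocal L 3 (Matrix.diagonal α) w₀),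
          (∫ p : ((∀ i : {w : {w : InfinitePlace L // IsComplex w} // w ∉ S' ∧ w ≠ w₀}, ↥(archLocal L 3 (Matrix.diagonal α) i.1)) ⧸
                Subgroup.pi Set.univ (fun i : {w : {w : InfinitePlace L // IsComplex w} // w ∉ S' ∧ w ≠ w₀} => chartTorusGLoc L α i.1 S')) ×
              ({w : {w : InfinitePlace L // IsComplex w} // w ∈ S'} → ↥K × ↥(unipotentU (starRingEnd ℂ) J)),
            descConj (fun i : {w : {w : InfinitePlace L // IsComplex w} // w ∉ S' ∧ w ≠ w₀} => gprimeBlock L α i.1 S' c)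
              (Subgroup.pi Set.univ (fun i : {w : {w : InfinitePlace L // IsComplex w} // w ∉ S' ∧ w ≠ w₀} => chartTorusGLoc L α i.1 S'))
              (forall_mem_pi_chartTorusGLoc_comm L α S' (fun i : {w : {w : InfinitePlace L // IsComplex w} // w ∉ S' ∧ w ≠ w₀} => i.1) c)
              (fun g => a' ((archPiEquivCM 3 L (Matrix.diagonal α)).symm
                ((MeasurableEquiv.piEquivPiSubtypeProd (fun w : {w : InfinitePlace L // IsComplex w} => ↥(archLocal L 3 (Matrix.diagonal α) w)) (· = w₀)).symm
                  ((MeasurableEquiv.piUnique fun i : {w : {w : InfinitePlace L // IsComplex w} // w = w₀} => ↥(archLocal L 3 (Matrix.diagonal α) i.1)).symm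
                      (x * gprimeBlockAt L α w₀ S' (c w₀) * x⁻¹),
                    fun w' : {w : {w : InfinitePlace L // IsComplex w} // ¬ w = w₀} =>
                      if h : w'.1 ∈ S' then
                        (φ ⟨w'.1, h⟩).symm (((p.2 ⟨w'.1, h⟩).1 : ↥(unitaryGroupOfForm (starRingEnd ℂ) J)) *
                          (τ ![0, c w'.1 1, c w'.1 2] * τ ![c w'.1 0 / 2, 0, 0] * ((p.2 ⟨w'.1, h⟩).2 : ↥(unitaryGroupOfForm (starRingEnd ℂ) J)) * τ ![c w'.1 0 / 2, 0, 0]) *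
                          ((p.2 ⟨w'.1, h⟩).1 : ↥(unitaryGroupOfForm (starRingEnd ℂ) J))⁻¹)
                      else (g ⟨w'.1, ⟨h, w'.2⟩⟩ : ↥(archLocal L 3 (Matrix.diagonal α) w'.1))))))
              p.1
            ∂((quotientMeasure (Subgroup.pi Set.univ (fun i : {w : {w : InfinitePlace L // IsComplex w} // w ∉ S' ∧ w ≠ w₀} => chartTorusGLoc L α i.1 S')) ρι
                  (isClosed_coe_pi _ fun i => isClosed_chartTorusGLoc L α i.1 S')
                  (Measure.pi fun i : {w : {w : InfinitePlace L // IsComplex w} // w ∉ S' ∧ w ≠ w₀} => ν'w i.1)).prod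
              (Measure.pi fun _ : {w : {w : InfinitePlace L // IsComplex w} // w ∈ S'} => κ.prod μN)))
          ∂(ν'w w₀) := by
  -- ### instances (as ★ (A1) §3 ∕ ★ (A5a)): the local quotient measures, the split fibre `K × N`, the ι-quotient spectator
  haveI : ∀ w : {w : InfinitePlace L // IsComplex w}, IsClosed (chartTorusGLoc L α w S' : Set ↥(archLocal L 3 (Matrix.diagonal α) w)) :=
    fun w => isClosed_chartTorusGLoc L α w S'
  haveI : ∀ w : {w : InfinitePlace L // IsComplex w}, SecondCountableTopology (↥(archLocal L 3 (Matrix.diagonal α) w) ⧸ chartTorusGLoc L α w S') := fun w => inferInstance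
  haveI : ∀ w : {w : {w : InfinitePlace L // IsComplex w} // w ∈ S'},
      SigmaFinite (quotientMeasure (chartTorusGLoc L α w.1 S') (t w.1) (isClosed_chartTorusGLoc L α w.1 S') (ν'w w.1)) := fun w => inferInstance
  haveI : ∀ w, LocallyCompactSpace ↥(chartTorusGLoc L α w S') := fun w => locallyCompactSpace_chartTorusGLoc L α w S'
  haveI : ∀ w, SecondCountableTopology ↥(chartTorusGLoc L α w S') := fun w => TopologicalSpace.Subtype.secondCountableTopology _
  haveI : ∀ w, SigmaFinite (t w) := fun w => inferInstance
  have hMι : IsClosed ((Subgroup.pi Set.univ (fun i : {w : {w : InfinitePlace L // IsComplex w} // w ∉ S' ∧ w ≠ w₀} => chartTorusGLoc L α i.1 S')) :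
      Set (∀ i : {w : {w : InfinitePlace L // IsComplex w} // w ∉ S' ∧ w ≠ w₀}, ↥(archLocal L 3 (Matrix.diagonal α) i.1))) :=
    isClosed_coe_pi _ fun i => isClosed_chartTorusGLoc L α i.1 S'
  haveI : LocallyCompactSpace ↥(Subgroup.pi Set.univ (fun i : {w : {w : InfinitePlace L // IsComplex w} // w ∉ S' ∧ w ≠ w₀} => chartTorusGLoc L α i.1 S')) :=
    hMι.isClosedEmbedding_subtypeVal.locallyCompactSpace
  haveI : SecondCountableTopology ↥(Subgroup.pi Set.univ (fun i : {w : {w : InfinitePlace L // IsComplex w} // w ∉ S' ∧ w ≠ w₀} => chartTorusGLoc L α i.1 S')) :=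
    TopologicalSpace.Subtype.secondCountableTopology _
  haveI : SFinite ρι := inferInstance
  haveI : LocallyCompactSpace ↥(unitaryGroupOfForm (starRingEnd ℂ) J) := locallyCompactSpace_unitaryGroupOfForm_complex J
  haveI : SecondCountableTopology ↥(unitaryGroupOfForm (starRingEnd ℂ) J) := secondCountableTopology_unitaryGroupOfForm_complex J
  have hN : IsClosed (unipotentU (starRingEnd ℂ) J : Set ↥(unitaryGroupOfForm (starRingEnd ℂ) J)) := LineRing.isClosed_unipotentU _ _
  haveI : LocallyCompactSpace ↥(unipotentU (starRingEnd ℂ) J) := hN.isClosedEmbedding_subtypeVal.locallyCompactSpace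
  -- ### torus data on `U(J₃)(ℂ)` (★ (A5a) verbatim): `φ_w γ_w(c) = τ(c_w) = τ(0,θ,φ) τ(x∕2,0,0) τ(x∕2,0,0)`, diagonal units from `hτd`
  choose d hd hdc using hτd
  have hγt : ∀ w : {w : {w : InfinitePlace L // IsComplex w} // w ∈ S'}, (φ w) (gprimeBlockAt L α w.1 S' (c w.1)) = τ (c w.1) := fun w => by
    apply Subtype.ext
    apply Units.ext
    rw [← hφd w (c w.1), coe_glDiagonal, hτcoe]
    rfl
  have htms : ∀ w : {w : {w : InfinitePlace L // IsComplex w} // w ∈ S'},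
      τ (c w.1) = τ ![0, c w.1 1, c w.1 2] * τ ![c w.1 0 / 2, 0, 0] * τ ![c w.1 0 / 2, 0, 0] := fun w => by
    conv_lhs => rw [splitCoord_eq_add_half_add_half (c w.1)]
    rw [hτmul, hτmul]
  -- ### Steps 0–3: `orbFamG = cpt · split · chartOrbG` and ★ part 1 (the `w₀`-place isolated, split quotients × ONE ι-quotient inside)
  rw [orbFamG_apply L α ν' a' hS' c, archRG_eq_prod_cpt_mul_prod_split S' c,
    chartOrbG_eq_prod_mul_integral_group_isolate_splitQuotient L α S' ν'w ν' hν t w₀ ρι hρι hα hS' hw₀ hc ha'c ha's]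
  -- ### Step 4: the (A3) integrand for a FIXED `w₀`-slot `x` is continuous on `(Π_{S′} U_w) × Ω_ι`
  have hFc : ∀ x : ↥(archLocal L 3 (Matrix.diagonal α) w₀), Continuous fun p :
      (∀ s : {w : {w : InfinitePlace L // IsComplex w} // w ∈ S'}, ↥(archLocal L 3 (Matrix.diagonal α) s.1)) ×
        ((∀ i : {w : {w : InfinitePlace L // IsComplex w} // w ∉ S' ∧ w ≠ w₀}, ↥(archLocal L 3 (Matrix.diagonal α) i.1)) ⧸
          Subgroup.pi Set.univ (fun i : {w : {w : InfinitePlace L // IsComplex w} // w ∉ S' ∧ w ≠ w₀} => chartTorusGLoc L α i.1 S')) =>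
      a' ((archPiEquivCM 3 L (Matrix.diagonal α)).symm
        ((MeasurableEquiv.piEquivPiSubtypeProd (fun w : {w : InfinitePlace L // IsComplex w} => ↥(archLocal L 3 (Matrix.diagonal α) w)) (· = w₀)).symm
          ((MeasurableEquiv.piUnique fun i : {w : {w : InfinitePlace L // IsComplex w} // w = w₀} => ↥(archLocal L 3 (Matrix.diagonal α) i.1)).symm
              (x * gprimeBlockAt L α w₀ S' (c w₀) * x⁻¹),
            fun w' : {w : {w : InfinitePlace L // IsComplex w} // ¬ w = w₀} =>
              if h : w'.1 ∈ S' then p.1 ⟨w'.1, h⟩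
              else
                descConj (fun i : {w : {w : InfinitePlace L // IsComplex w} // w ∉ S' ∧ w ≠ w₀} => gprimeBlock L α i.1 S' c)
                  (Subgroup.pi Set.univ (fun i : {w : {w : InfinitePlace L // IsComplex w} // w ∉ S' ∧ w ≠ w₀} => chartTorusGLoc L α i.1 S'))
                  (forall_mem_pi_chartTorusGLoc_comm L α S' (fun i : {w : {w : InfinitePlace L // IsComplex w} // w ∉ S' ∧ w ≠ w₀} => i.1) c)
                  (fun g => (g ⟨w'.1, ⟨h, w'.2⟩⟩ : ↥(archLocal L 3 (Matrix.diagonal α) w'.1))) p.2))) := fun x => by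
    refine ha'c.comp ((archPiEquivCM 3 L (Matrix.diagonal α)).symm.continuous.comp ?_)
    have hsymm : Continuous (MeasurableEquiv.piEquivPiSubtypeProd
        (fun w : {w : InfinitePlace L // IsComplex w} => ↥(archLocal L 3 (Matrix.diagonal α) w)) (· = w₀)).symm :=
      (Homeomorph.piEquivPiSubtypeProd (· = w₀) (fun w : {w : InfinitePlace L // IsComplex w} => ↥(archLocal L 3 (Matrix.diagonal α) w))).symm.continuous
    refine hsymm.comp (continuous_const.prodMk (continuous_pi fun w' => ?_))
    by_cases h : w'.1 ∈ S'
    · simp only [dif_pos h]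
      exact (continuous_apply _).comp continuous_fst
    · simp only [dif_neg h]
      exact (continuous_descConj _ _ _ (continuous_apply _)).comp continuous_snd
  -- ### Steps 4–5 pointwise in `x`: ★ (A2)+(A3) with spectator `Ω_ι` absorbs `Π_{S′} Δ_w`, then ★ (A5b) folds the ι-class first
  have hpt := fun x : ↥(archLocal L 3 (Matrix.diagonal α) w₀) => by
    have hB := prod_normaliser_smul_integral_pi_descConj_eq_smul_integral_pi_prod_symm hJ
      (fun w : {w : {w : InfinitePlace L // IsComplex w} // w ∈ S'} => chartTorusGLoc L α w.1 S')
      (fun w => quotientMeasure (chartTorusGLoc L α w.1 S') (t w.1) (isClosed_chartTorusGLoc L α w.1 S') (ν'w w.1)) φ hφT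
      (fun _ => K) (fun _ => κ) (fun _ => μN) hμC (fun w => forall_mem_chartTorusGLoc_comm L α w.1 S' (c w.1)) hγt
      (fun w => hτT _) (fun w => hτT _) htms (fun w => c w.1) (fun w => hc.2 w.1 w.2)
      (fun w => hd _) (fun w j => hdc _ j) (fun w => hd _) (fun w j => hdc _ j)
      (quotientMeasure (Subgroup.pi Set.univ (fun i : {w : {w : InfinitePlace L // IsComplex w} // w ∉ S' ∧ w ≠ w₀} => chartTorusGLoc L α i.1 S')) ρι
        (isClosed_coe_pi _ fun i => isClosed_chartTorusGLoc L α i.1 S')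
        (Measure.pi fun i : {w : {w : InfinitePlace L // IsComplex w} // w ∉ S' ∧ w ≠ w₀} => ν'w i.1)) _ (hFc x)
    have hswap := integral_prod_eq_integral_swap_descConj
      (fun i : {w : {w : InfinitePlace L // IsComplex w} // w ∉ S' ∧ w ≠ w₀} => gprimeBlock L α i.1 S' c)
      (Subgroup.pi Set.univ (fun i : {w : {w : InfinitePlace L // IsComplex w} // w ∉ S' ∧ w ≠ w₀} => chartTorusGLoc L α i.1 S'))
      (forall_mem_pi_chartTorusGLoc_comm L α S' (fun i : {w : {w : InfinitePlace L // IsComplex w} // w ∉ S' ∧ w ≠ w₀} => i.1) c)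
      (Measure.pi fun _ : {w : {w : InfinitePlace L // IsComplex w} // w ∈ S'} => κ.prod μN)
      (quotientMeasure (Subgroup.pi Set.univ (fun i : {w : {w : InfinitePlace L // IsComplex w} // w ∉ S' ∧ w ≠ w₀} => chartTorusGLoc L α i.1 S')) ρι
        (isClosed_coe_pi _ fun i => isClosed_chartTorusGLoc L α i.1 S')
        (Measure.pi fun i : {w : {w : InfinitePlace L // IsComplex w} // w ∉ S' ∧ w ≠ w₀} => ν'w i.1))
      a'
      (fun gu : (∀ i : {w : {w : InfinitePlace L // IsComplex w} // w ∉ S' ∧ w ≠ w₀}, ↥(archLocal L 3 (Matrix.diagonal α) i.1)) ×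
          ({w : {w : InfinitePlace L // IsComplex w} // w ∈ S'} → ↥K × ↥(unipotentU (starRingEnd ℂ) J)) =>
        (archPiEquivCM 3 L (Matrix.diagonal α)).symm
          ((MeasurableEquiv.piEquivPiSubtypeProd (fun w : {w : InfinitePlace L // IsComplex w} => ↥(archLocal L 3 (Matrix.diagonal α) w)) (· = w₀)).symm
            ((MeasurableEquiv.piUnique fun i : {w : {w : InfinitePlace L // IsComplex w} // w = w₀} => ↥(archLocal L 3 (Matrix.diagonal α) i.1)).symm
                (x * gprimeBlockAt L α w₀ S' (c w₀) * x⁻¹),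
              fun w' : {w : {w : InfinitePlace L // IsComplex w} // ¬ w = w₀} =>
                if h : w'.1 ∈ S' then
                  (φ ⟨w'.1, h⟩).symm (((gu.2 ⟨w'.1, h⟩).1 : ↥(unitaryGroupOfForm (starRingEnd ℂ) J)) *
                    (τ ![0, c w'.1 1, c w'.1 2] * τ ![c w'.1 0 / 2, 0, 0] * ((gu.2 ⟨w'.1, h⟩).2 : ↥(unitaryGroupOfForm (starRingEnd ℂ) J)) * τ ![c w'.1 0 / 2, 0, 0]) *
                    ((gu.2 ⟨w'.1, h⟩).1 : ↥(unitaryGroupOfForm (starRingEnd ℂ) J))⁻¹)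
                else (gu.1 ⟨w'.1, ⟨h, w'.2⟩⟩ : ↥(archLocal L 3 (Matrix.diagonal α) w'.1)))))
      (fun q : ({w : {w : InfinitePlace L // IsComplex w} // w ∈ S'} → ↥K × ↥(unipotentU (starRingEnd ℂ) J)) ×
          ((∀ i : {w : {w : InfinitePlace L // IsComplex w} // w ∉ S' ∧ w ≠ w₀}, ↥(archLocal L 3 (Matrix.diagonal α) i.1)) ⧸
            Subgroup.pi Set.univ (fun i : {w : {w : InfinitePlace L // IsComplex w} // w ∉ S' ∧ w ≠ w₀} => chartTorusGLoc L α i.1 S')) =>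
        a' ((archPiEquivCM 3 L (Matrix.diagonal α)).symm
          ((MeasurableEquiv.piEquivPiSubtypeProd (fun w : {w : InfinitePlace L // IsComplex w} => ↥(archLocal L 3 (Matrix.diagonal α) w)) (· = w₀)).symm
            ((MeasurableEquiv.piUnique fun i : {w : {w : InfinitePlace L // IsComplex w} // w = w₀} => ↥(archLocal L 3 (Matrix.diagonal α) i.1)).symm
                (x * gprimeBlockAt L α w₀ S' (c w₀) * x⁻¹),
              fun w' : {w : {w : InfinitePlace L // IsComplex w} // ¬ w = w₀} =>
                if h : w'.1 ∈ S' then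
                  (φ ⟨w'.1, h⟩).symm (((q.1 ⟨w'.1, h⟩).1 : ↥(unitaryGroupOfForm (starRingEnd ℂ) J)) *
                    (τ ![0, c w'.1 1, c w'.1 2] * τ ![c w'.1 0 / 2, 0, 0] * ((q.1 ⟨w'.1, h⟩).2 : ↥(unitaryGroupOfForm (starRingEnd ℂ) J)) * τ ![c w'.1 0 / 2, 0, 0]) *
                    ((q.1 ⟨w'.1, h⟩).1 : ↥(unitaryGroupOfForm (starRingEnd ℂ) J))⁻¹)
                else
                  descConj (fun i : {w : {w : InfinitePlace L // IsComplex w} // w ∉ S' ∧ w ≠ w₀} => gprimeBlock L α i.1 S' c)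
                    (Subgroup.pi Set.univ (fun i : {w : {w : InfinitePlace L // IsComplex w} // w ∉ S' ∧ w ≠ w₀} => chartTorusGLoc L α i.1 S'))
                    (forall_mem_pi_chartTorusGLoc_comm L α S' (fun i : {w : {w : InfinitePlace L // IsComplex w} // w ∉ S' ∧ w ≠ w₀} => i.1) c)
                    (fun g => (g ⟨w'.1, ⟨h, w'.2⟩⟩ : ↥(archLocal L 3 (Matrix.diagonal α) w'.1))) q.2))))
      (fun u g => rfl)
    have h := hB.trans (congrArg (fun y => (∏ w : {w : {w : InfinitePlace L // IsComplex w} // w ∈ S'}, (C w : ℝ)) • y) hswap)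
    beta_reduce at h
    rw [Complex.real_smul, Complex.real_smul, Complex.ofReal_prod] at h
    exact h
  -- ### assembly: integrate the pointwise identity in `x`, pull the constants, `orbFamG = cpt · split · (Π_{w≠w₀} t_w(B′_w)) · ∫ …`
  have hI := integral_congr_ae (μ := ν'w w₀) (Filter.Eventually.of_forall hpt)
  rw [integral_const_mul, integral_const_mul] at hI
  linear_combination ((∏ w ∈ Finset.univ.filter (fun w => w ∉ S'),
      ((1 - (Circle.exp (c w 1 - c w 0) : ℂ)) * (1 - (Circle.exp (c w 2 - c w 0) : ℂ)) * (1 - (Circle.exp (c w 2 - c w 1) : ℂ)))) *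
    (∏ w' : {w : {w : InfinitePlace L // IsComplex w} // ¬ w = w₀}, ((t w'.1 (chartBoxImgGLoc L α w'.1 S')).toReal : ℂ))) * hI

end Isolate

end Literature.NumberTheory.Rogawski1990

end
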